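import Summits.PneNP.PneNP.Theses.PhaseTwins
import Summits.PneNP.PneNP.Theorems.PhaseTwinsPolyDepthTwinsAboveDefs
import Summits.PneNP.PneNP.Theorems.PhaseTwinsPolyDepthTwinsAboveChargeVisible
import Summits.PneNP.PneNP.Theorems.PolyDepthTwinsAbove.Negative.LoadBearing
import Literature.Computability.Complexity.HardcoreInapproximability
import Literature.ModelTheory.FiniteModelTheory.CFIMatchingGraphs
import Literature.ModelTheory.FiniteModelTheory.CkEquivHomCount
import Literature.ModelTheory.FiniteModelTheory.CkEquivTransfer
import Literature.ModelTheory.FiniteModelTheory.XorLocalConsistency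

/-!
# Line `linear-gap-constant-gadgets` for crux `PhaseTwins.PolyDepthTwinsAbove` (stmt-PneNP-2719)

Skeleton (crux-plan, planner-cruxplan-stmt-PneNP-2719-linear-gap-constant--0, 2026-08-16) of the crux idea
`linear-gap-constant-gadgets` (crux-ideate r1, ideator 2; triage r1-2: pass "the strongest proposal on the panel",
r1-3: pass), with the triage sharpenings built in: (a) the energy lemma is stated SECTORWISE with LOCAL accounting
(an aligned variable is charged only for the `≤ D` equations it touches; Disproof.lean §5(3b)); (b) the copy-explicit
connector sandwich (Sly's Lemma 2.2 at CONSTANT gadget error `δ = n^{-2θ}`, `2·nv` copies, NO bound on `nv`) is its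
own stub; (c) the bounded-occurrence linear-radius expander with a far right-hand side is a named stub — and it is
PROVABLE NOW from the tree (`Xor3Gap.exists_threeUniformExpander` + `SparseOrData.splitScope` +
`SparseOrData.exists_far`), which the card's `exists_boundaryExpander` (no occurrence bound) was not; (d) the gadget
layer is the symmetric copy pair with two-sided pair bundles (`pairW` of the landed definitions file p72174) = the
`mirror-glued-gadget` object, as all three triagers asked.

SHARED OBJECT (important for staffing). The construction below — ONE Sly gadget per LITERAL `(x, a)`, `κ₁` two-sided
pair bundles per variable, `K` ten-vertex CFI complexes per equation, the graph `lgGraph E loc W b` on the uniform vertex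
type `LGVert nv m v K` — is VERBATIM the object of the sibling crux's line
`Cruxes/MacroscopicTwinsAbove/Lines/literal-gadgets-cfi-apparatus.lean` (stmt-PneNP-2720, same day, independent
planner; convergent design). Definitions and the generic stubs S1, S3, S4, S5, S7 are copied with IDENTICAL names and
signatures, S6 is its part (ii) with the contrast `Ψ1 ≤ Ψ0` as a hypothesis (part (i) is LANDED:
`ParityWiredPorts.stub_chargeVisible`, `Theorems/PhaseTwinsPolyDepthTwinsAboveChargeVisible.lean`), so that ONE
definitions file and ONE proof per stub serve both cruxes. What THIS line adds: the source S2 at LINEAR radius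
(`stub_linearSystems`, replacing the per-`k` girth source of 2720) and the PROVED transfer
`linearGapTwins` (C⁺ of the card: depth `Ω(nv)`, ratio `e^{nv}`, size `Θ(nv)`) ⇒ `PolyDepthTwinsAbove` (θ = 1/2)
AND ⇒ `MacroscopicTwinsAbove` (`macroscopicTwinsAbove_of_linearGap`): the card's "C⁺ ⇒ #2 ∧ #3".

THE LINE. Fix `Δ ≥ 3`, `λ > λ_c(Δ)`. S1 (Sly 2010 Thm 2.1 derandomised = hypothesis `h21` of
`slyGadgetReduction_of_gadgets`, the declared trust base of every Sly-based line on 2719/2720) gives `d ≤ Δ`, `θ`,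
`0 < q⁻ < q⁺ < 1` and gadgets for all large sizes; the LANDED contrast identity gives `g = Ψ0 − Ψ1 > 0`
(`F₀ − F₁ = λ⁴(q⁺−q⁻)³/(1+λ)^{10}`); S2 gives absolute constants `D, c, η, γ`; S7 fixes ONE gadget size `n` and numbers
`K, κ₁` (port budget `κ₁ + DK ≤ slyM d θ n`, sector inequality `K·D·log ρ_F ≤ κ₁·log B`, `n^{-2θ} ≤ 1/2`, per-variable
budget `1 + 2 log(3n) ≤ K η g`); the gadget `W` at `n` is fixed BEFORE the system. For every `n₀`, S2 supplies a 3-XOR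
system `E : Fin m → Fin 3 → Fin nv` (`nv ≥ n₀`, three distinct variables per equation, occurrences properly
`D`-coloured by `loc`, `nv ≤ m ≤ c·nv`) that is an `(s, 1/2)`-BOUNDARY EXPANDER at LINEAR radius `s ≥ γ·nv`, with a
right-hand side `b` that is `t`-FAR, `t ≥ η m`: every assignment violates `≥ t` equations. Twins:
`𝔊₀ = lgGraph E loc W 0`, `𝔊_b = lgGraph E loc W b` on `N = 2·nv·v + 10·m·K ≤ (2v + 10cK)·nv` vertices.
DUPLICATOR (S3): gauge flips `lgFlip E f` permute literal gadgets as blocks and relabel complex vertices, never a port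
(`isLocalFlipAction_lgFlip`, PROVED), so `ckEquiv_of_consistencyFamily` with the consistency family
`XorSystem.Good (lgScope E) b s` (`isConsistencyFamily_good`, `q = 1, p = 2`, bound `K₀ = 3k` for `12k ≤ s`) gives
`𝔊₀ ≡_{C^k} 𝔊_b` for every `k ≤ s/12 = Ω(nv) = Ω(N)`. ENERGY: S5 (copy-explicit Lemma 2.2) sandwiches
`Z_{𝔊_b}(Y) ∈ (1 ± δ)^{2nv} · lgW b Y · Z_base(Y)`; S6 (sector optimisation with local accounting) gives
`lgW b Y · e^{K t g} ≤ lgW 0 ref` for EVERY phase vector `Y`; `budget_exp` + `twins_of_estimates` (PROVED) give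
`e^{nv} · Z(𝔊_b) ≤ Z(𝔊₀)`. Degrees `≤ Δ` by S4. `linearGapTwins` packages this (kernel-checked from the stubs);
`PolyDepthTwinsAbove_of` takes `θ = 1/2` (`N^{1/2} ≤ s/12` and `e^{nv} ≥ 2` for `nv` beyond an explicit threshold)
and converts `≡_{C^k}` into the typed hom-count clause by the PROVED Dvořák bridge `Dvorak2010.homCount_eq_of_ckEquiv`.

Stubs (7): `stub_slyGadgets` (XL; trust base, identical to both sibling lines' S1 — NOT a lead-prover target),
`stub_linearSystems` (M; PROVABLE NOW: SparseOrData/Xor3Gap, see its docstring), `stub_duplicator` (M; = 2720 S3),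
`stub_maxDegree` (S–M; = 2720 S4), `stub_connector` (L; HARDEST provable-now; = 2720 S5), `stub_energy` (M; = 2720
S6(ii) + `hΨ`), `stub_parameters` (M; = 2720 S7).

Disproof.lean (cdisprove gen 1–2 on THIS crux) honoured: §1 `polyDepthTwinsAbove_false_without_threshold` /
`_false_without_degreeLB` (LANDED as `Theorems/PolyDepthTwinsAbove/Negative/LoadBearing.lean`, imported above): the
threshold is used exactly once, in S1 (`q⁻ < q⁺` exists only above `λ_c(d)`) and read exactly once, through the landed
contrast `g > 0`; `3 ≤ Δ` enters S1 and S4. §2 `bareCFI_defect_identity` (bare CFI lifts are only `log n`-deep):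
not used — the parity signal is carried by COUPLED gadget spins and amplified by `K` complexes per equation over
`≥ t = Θ(m)` violated equations. §3(ii) (factor 2 ⇔ factor c): consistent, we prove `e^{nv}`. §5 (round-2 remarks
on this very card): (3a) an alignment penalty is necessary — it is the hypothesis `hcouple` of S6; (3b) LOCAL
accounting — S6 charges an aligned variable for its `≤ D` equations only (`K·D·log ρ_F ≤ κ₁·log B`, independent of
`m`); (3c) `g` small near `λ_c` — absorbed by the constant `K` of S7; (4) far XOR twins need both systems `K₀`-locally
satisfiable — `XorSystem.Good` works for EVERY right-hand side. Sibling crux 2720's landed `Negative/DefectBound`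
(twins must differ on `Ω(δN/log(1+λ))` vertices under every alignment): under every gauge `f` the twins differ on the
`K·#viol(b + ∂f) ≥ K t = Θ(N)` charged complexes. Negatives index (PneNP: 0265, 0988, 10247, 2493, 2222): unrelated.
-/

noncomputable section

open scoped Classical BigOperators

namespace Summit.PneNP.PneNP.Cruxes.PolyDepthTwinsAbove.LinearGapConstantGadgets

open Finset
open Literature.Computability.Complexity (hardcoreZOn slyPhase SlyPropA SlyPropB slyB slyM
  slyGadgetReduction one_lt_slyB sum_hardcoreZOn_fiber le_and_le_of_abs_sub_le hardcoreZOn_nonneg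
  hardcoreZOn_le_independencePolynomial)
open Literature.ModelTheory.FiniteModelTheory (CkEquiv IsConsistencyFamily IsLocalFlipAction
  ckEquiv_of_consistencyFamily)
open Literature.ModelTheory.FiniteModelTheory.CFIMatching (bit)
open Literature.Probability.LatticeModels (independencePolynomial hardCoreThreshold hardCoreThreshold_pos
  independencePolynomial_pos)
open Literature.Combinatorics.SimpleGraph (treewidth)
open Summit.PneNP.PneNP.Theses.PhaseTwins (PolyDepthTwinsAbove MacroscopicTwinsAbove)
open Summit.PneNP.PneNP.Cruxes.PolyDepthTwinsAbove.ParityWiredPorts (occP occM pairW CxVert cxGraph cxWeight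
  cxW pwPsi cxRho)

set_option linter.unusedVariables false
set_option linter.dupNamespace false

variable {nv m v P κ₁ D K : ℕ}

/-! ## The construction (verbatim the object of `MacroscopicTwinsAbove/Lines/literal-gadgets-cfi-apparatus.lean`;
keep names and signatures identical — one definitions file should serve both lines) -/

/-- Vertices of the literal-gadget graph: COPY vertices `(x, a, y)` (vertex `y : Fin v` of the literal gadget
`g_{x,a}`, one copy per variable `x` and value `a`), END vertices `(e, j, i, a)` and INNER vertices
`(e, j, S')` of the `j`-th (`j < K`) ten-vertex CFI complex of equation `e`. Uniform in the system and in the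
right-hand side (one vertex type for both twins). -/
abbrev LGVert (nv m v K : ℕ) : Type :=
  (Fin nv × ZMod 2 × Fin v) ⊕ (Fin m × Fin K × Fin 3 × ZMod 2) ⊕ (Fin m × Fin K × (Fin 2 → ZMod 2))

/-- A gadget with its wiring data: Sly's `(G, W⁺, W⁻, V⁺, V⁻)` on `Fin v` with `P` ports of each sign, and an
injective SLOT assignment: `κ₁` pair slots and `D·K` end slots (occurrence colour `ℓ < D`, copy index `j < K`). -/
structure LWiring (v P κ₁ D K : ℕ) where
  G : SimpleGraph (Fin v)
  Wp : Finset (Fin v)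
  Wm : Finset (Fin v)
  Vp : Fin P ↪ Fin v
  Vm : Fin P ↪ Fin v
  slot : Fin κ₁ ⊕ (Fin D × Fin K) ↪ Fin P

/-- The slot assignment from a cardinality bound (slots `0 … κ₁ + DK − 1`). -/
def slotEmb {κ₁ D K P : ℕ} (h : Fintype.card (Fin κ₁ ⊕ (Fin D × Fin K)) ≤ P) :
    Fin κ₁ ⊕ (Fin D × Fin K) ↪ Fin P :=
  (Fintype.equivFin (Fin κ₁ ⊕ (Fin D × Fin K))).toEmbedding.trans (Fin.castLEEmb h)

/-- The scope of equation `e` as a set of variables (shape of `XorSystem.boundary` / `XorSystem.Good`). -/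
def lgScope (E : Fin m → Fin 3 → Fin nv) (e : Fin m) : Finset (Fin nv) := Finset.univ.image (E e)

/-- Generating adjacency of `lgGraph E loc W b`: (copy–copy) the gadget inside each literal gadget, and the
`κ₁ + κ₁` PAIR edges `V⁺(slot j)—V⁺(slot j)`, `V⁻(slot j)—V⁻(slot j)` between `g_{x,0}` and `g_{x,1}`;
(end–copy) the end `(e, j, i, a)` is adjacent to the `V⁺` port in end slot `(loc (e,i), j)` of `g_{E e i, a}`;
(inner–end) `(e, j, S') — (e, j, i, bit (b e) S' i)` (the CFI complex of charge `b e`). -/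
def lgRel (E : Fin m → Fin 3 → Fin nv) (loc : Fin m × Fin 3 → Fin D) (W : LWiring v P κ₁ D K)
    (b : Fin m → ZMod 2) : LGVert nv m v K → LGVert nv m v K → Prop
  | .inl (x, a, y), .inl (x', a', y') =>
      (x' = x ∧ a' = a ∧ W.G.Adj y y') ∨
      (x' = x ∧ a' = a + 1 ∧ ∃ j : Fin κ₁,
        (y = W.Vp (W.slot (Sum.inl j)) ∧ y' = W.Vp (W.slot (Sum.inl j))) ∨
        (y = W.Vm (W.slot (Sum.inl j)) ∧ y' = W.Vm (W.slot (Sum.inl j))))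
  | .inr (.inl (e, j, i, a)), .inl (x', a', y') =>
      x' = E e i ∧ a' = a ∧ y' = W.Vp (W.slot (Sum.inr (loc (e, i), j)))
  | .inr (.inr (e, j, S')), .inr (.inl (e', j', i, a)) => e' = e ∧ j' = j ∧ bit (b e) S' i = a
  | _, _ => False

/-- **The literal-gadget graph** `𝔊(E, b)` over the system `E`, the occurrence colouring `loc`, the gadget/wiring
`W` and the right-hand side `b`. -/
def lgGraph (E : Fin m → Fin 3 → Fin nv) (loc : Fin m × Fin 3 → Fin D) (W : LWiring v P κ₁ D K)
    (b : Fin m → ZMod 2) : SimpleGraph (LGVert nv m v K) :=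
  SimpleGraph.fromRel (lgRel E loc W b)

/-- Generating adjacency of the connector-free, coupling-free graph: the `2·nv` disjoint literal gadgets
(end and inner vertices isolated). -/
def lgBaseRel (nv m : ℕ) (W : LWiring v P κ₁ D K) : LGVert nv m v K → LGVert nv m v K → Prop
  | .inl (x, a, y), .inl (x', a', y') => x' = x ∧ a' = a ∧ W.G.Adj y y'
  | _, _ => False

/-- The disjoint union of the literal gadgets (Sly's `Ĥ^G` for this wiring). -/
def lgBase (nv m : ℕ) (W : LWiring v P κ₁ D K) : SimpleGraph (LGVert nv m v K) :=
  SimpleGraph.fromRel (lgBaseRel nv m W)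

/-- The configuration on the literal gadget `g`: its fibre. -/
def lgFib (I : Finset (LGVert nv m v K)) (g : Fin nv × ZMod 2) : Finset (Fin v) :=
  univ.filter fun y => (Sum.inl (g.1, g.2, y) : LGVert nv m v K) ∈ I

/-- The PHASE VECTOR of a configuration: Sly's phase of its restriction to every literal gadget. -/
def lgPhase (W : LWiring v P κ₁ D K) (I : Finset (LGVert nv m v K)) : Fin nv × ZMod 2 → Bool :=
  fun g => slyPhase W.Wp W.Wm (lgFib I g)

/-- The reference (planted) phase vector: `g_{x,0}` in phase `+`, `g_{x,1}` in phase `−`, for every `x`. -/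
def lgRef {nv : ℕ} : Fin nv × ZMod 2 → Bool := fun p => decide (p.2 = 0)

/-- **The weight of a phase vector** `Y` under the right-hand side `b` (product-measure value of the wiring
given the phases): the pair factor of every variable times the `K`-th power of the complex factor of every
equation (all `K` complexes of `e` read the phases of the six literal gadgets `g_{E e i, a}`). -/
def lgW (E : Fin m → Fin 3 → Fin nv) (lam qp qm : ℝ) (κ₁ K : ℕ) (b : Fin m → ZMod 2)
    (Y : Fin nv × ZMod 2 → Bool) : ℝ :=
  (∏ x : Fin nv, pairW qp qm κ₁ (Y (x, 0)) (Y (x, 1))) *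
    ∏ e : Fin m, cxW lam qp qm (b e) (fun p => Y (E e p.1, p.2)) ^ K

/-- **The conclusions of the copy-explicit Lemma 2.2 for the literal-gadget wiring**: for every phase vector
`Y`, `(phaseProbs)` `Z_base(Y) ≥ n^{-2nv} Z_base` and the two-sided `(cutProb)`
`(1-δ)^{2nv} · lgW b Y · Z_base(Y) ≤ Z_{𝔊(E,b)}(Y) ≤ (1+δ)^{2nv} · lgW b Y · Z_base(Y)` — errors explicit in the
number `2nv` of gadget copies, NO bound on `nv`. -/
def LGCutEstimate (E : Fin m → Fin 3 → Fin nv) (loc : Fin m × Fin 3 → Fin D) (W : LWiring v P κ₁ D K)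
    (lam qp qm δ : ℝ) (n : ℕ) (b : Fin m → ZMod 2) : Prop :=
  ∀ Y : Fin nv × ZMod 2 → Bool,
    ((n : ℝ) ^ (2 * nv))⁻¹ * independencePolynomial (lgBase nv m W) lam ≤
        hardcoreZOn (lgBase nv m W) lam (fun I => lgPhase W I = Y) ∧
      (1 - δ) ^ (2 * nv) * (lgW E lam qp qm κ₁ K b Y *
          hardcoreZOn (lgBase nv m W) lam (fun I => lgPhase W I = Y)) ≤
        hardcoreZOn (lgGraph E loc W b) lam (fun I => lgPhase W I = Y) ∧
      hardcoreZOn (lgGraph E loc W b) lam (fun I => lgPhase W I = Y) ≤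
        (1 + δ) ^ (2 * nv) * (lgW E lam qp qm κ₁ K b Y *
          hardcoreZOn (lgBase nv m W) lam (fun I => lgPhase W I = Y))

/-- The gauge action of an assignment `f` on the vertices (S3's flip; a port is never renamed): literal gadgets
are permuted as blocks, complex vertices relabelled inside their complex. -/
def lgFlipFun (E : Fin m → Fin 3 → Fin nv) (f : Fin nv → ZMod 2) : LGVert nv m v K → LGVert nv m v K
  | .inl (x, a, y) => .inl (x, a + f x, y)
  | .inr (.inl (e, j, i, a)) => .inr (.inl (e, j, i, a + f (E e i)))
  | .inr (.inr (e, j, S')) => .inr (.inr (e, j, S' + fun i => f (E e (Fin.castSucc i))))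

/-- The data of a vertex (the variables whose flips move it or its edges): `≤ 3` variables. -/
def lgData (E : Fin m → Fin 3 → Fin nv) : LGVert nv m v K → Finset (Fin nv)
  | .inl (x, _, _) => {x}
  | .inr (.inl (e, _, i, _)) => {E e i}
  | .inr (.inr (e, _, _)) => lgScope E e

/-- The data of a vertex has at most three variables (`c₀ = 3` in `ckEquiv_of_consistencyFamily`). -/
theorem card_lgData_le (E : Fin m → Fin 3 → Fin nv) (x : LGVert nv m v K) : (lgData E x).card ≤ 3 := by
  rcases x with ⟨x, a, y⟩ | ⟨e, j, i, a⟩ | ⟨e, j, S'⟩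
  · simp [lgData]
  · simp [lgData]
  · simp only [lgData, lgScope]
    exact Finset.card_image_le.trans (by simp)

/-- Flips preserve the data (the `data_apply` field of `IsLocalFlipAction`). -/
theorem lgData_lgFlipFun (E : Fin m → Fin 3 → Fin nv) (f : Fin nv → ZMod 2) (x : LGVert nv m v K) :
    lgData E (lgFlipFun (v := v) (K := K) E f x) = lgData E x := by
  rcases x with ⟨x, a, y⟩ | ⟨e, j, i, a⟩ | ⟨e, j, S'⟩ <;> rfl

/-- Flipping twice by the same assignment is the identity (`ZMod 2`). -/
theorem lgFlipFun_lgFlipFun (E : Fin m → Fin 3 → Fin nv) (f : Fin nv → ZMod 2) (x : LGVert nv m v K) :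
    lgFlipFun E f (lgFlipFun E f x) = x := by
  have h2 : ∀ a : ZMod 2, a + a = 0 := by decide
  have h3 : ∀ g : Fin 2 → ZMod 2, g + g = 0 := fun g => funext fun i => h2 (g i)
  rcases x with ⟨x, a, y⟩ | ⟨e, j, i, a⟩ | ⟨e, j, S'⟩
  · simp [lgFlipFun, add_assoc, h2]
  · simp [lgFlipFun, add_assoc, h2]
  · simp [lgFlipFun, add_assoc, h3]

/-- **The flip** by `f` as a permutation of the vertices (an involution). -/
def lgFlip (E : Fin m → Fin 3 → Fin nv) (f : Fin nv → ZMod 2) : LGVert nv m v K ≃ LGVert nv m v K :=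
  Function.Involutive.toPerm (lgFlipFun E f) (lgFlipFun_lgFlipFun E f)

/-- The flips form a LOCAL FLIP ACTION for the data map `lgData` (one of the three inputs of the transfer theorem
`ckEquiv_of_consistencyFamily` in S3, PROVED): the image of a vertex depends only on `f` restricted to its data,
and the data is preserved. -/
theorem isLocalFlipAction_lgFlip (E : Fin m → Fin 3 → Fin nv) :
    IsLocalFlipAction (lgData (v := v) (K := K) E) (lgFlip E) := by
  refine ⟨fun f g x hfg => ?_, fun f x => lgData_lgFlipFun E f x⟩
  show lgFlipFun E f x = lgFlipFun E g x
  rcases x with ⟨x, a, y⟩ | ⟨e, j, i, a⟩ | ⟨e, j, S'⟩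
  · have h := hfg x (by simp [lgData])
    simp [lgFlipFun, h]
  · have h := hfg (E e i) (by simp [lgData])
    simp [lgFlipFun, h]
  · have h : ∀ i : Fin 2, f (E e (Fin.castSucc i)) = g (E e (Fin.castSucc i)) :=
      fun i => hfg _ (by simp [lgData, lgScope])
    simp [lgFlipFun, h]

/-! ## The stubs -/

/-- **S1 — Sly's phase gadgets = Sly 2010 Theorem 2.1, derandomised (GŠV16 Lemma 19; GGŠVY Lemma 5 / Cor. 6
for the degree covering).** Literally the hypothesis `h21` of the tree's `slyGadgetReduction_of_gadgets`, hence
EQUIVALENT to the named fact `slyGadgetReduction`, and VERBATIM the statement of `stub_slyGadgets` of the sibling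
lines `parity-wired-ports` (crux 2719) and `literal-gadgets-cfi-apparatus` (crux 2720) — one proof serves all
three. For `Δ ≥ 3`, `λ > λ_c(Δ)`: `d ∈ [3, Δ]` with `λ > λ_c(d)`, `θ ∈ (0, 1/8)`, `0 < q⁻ < q⁺ < 1` and, for all
large `n`, a gadget on `≤ 3n` vertices of maximum degree `≤ d`, `2·slyM d θ n` distinct ports of degree `≤ d − 1`,
`(GpropA)` at `n`, `(GpropB)` with `δ = n^{-2θ}`. THIS line uses it at ONE size `n = n(Δ, λ)` only (no
`SlyCutEstimate`, no `N ≤ n^{θ/4}`): exactly the card's "Sly's fact enters ONCE, at a constant size". The declared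
trust base (Disproof §0: "¬crux ⇒ ¬slyGadgetReduction"); size XL; NOT a lead-prover target (tree programme
`HardcoreInapproximabilityProofs`: two-cycle `q±`, first moments, `Φ₁` maxima done; second moment / small-subgraph
conditioning / reconstruction remain). -/
theorem stub_slyGadgets : ∀ Δ : ℕ, 3 ≤ Δ → ∀ lam : ℝ, hardCoreThreshold Δ < lam →
    ∃ d : ℕ, 3 ≤ d ∧ d ≤ Δ ∧ hardCoreThreshold d < lam ∧
    ∃ θ qp qm : ℝ, 0 < θ ∧ θ < 1 / 8 ∧ 0 < qm ∧ qm < qp ∧ qp < 1 ∧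
      ∃ n₁ : ℕ, ∀ n : ℕ, n₁ ≤ n →
        ∃ (v : ℕ) (G : SimpleGraph (Fin v)) (Wp Wm : Finset (Fin v))
          (Vp Vm : Fin (slyM d θ n) ↪ Fin v),
          (v : ℝ) ≤ 3 * n ∧ G.maxDegree ≤ d ∧ Disjoint Wp Wm ∧
            Disjoint (Set.range Vp) (Set.range Vm) ∧
            (∀ i, G.degree (Vp i) ≤ d - 1) ∧ (∀ i, G.degree (Vm i) ≤ d - 1) ∧
            SlyPropA G lam Wp Wm n ∧
            SlyPropB G lam Wp Wm Vp Vm qp qm ((n : ℝ) ^ (-(2 * θ))) := by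
  sorry

/-- S1 is exactly what the named fact `slyGadgetReduction` provides (sanity link, PROVED: the fact implies the
stub's statement; the converse direction is `slyGadgetReduction_of_gadgets`). -/
example (h : slyGadgetReduction) : ∀ Δ : ℕ, 3 ≤ Δ → ∀ lam : ℝ, hardCoreThreshold Δ < lam →
    ∃ d : ℕ, 3 ≤ d ∧ d ≤ Δ ∧ hardCoreThreshold d < lam ∧
    ∃ θ qp qm : ℝ, 0 < θ ∧ θ < 1 / 8 ∧ 0 < qm ∧ qm < qp ∧ qp < 1 ∧
      ∃ n₁ : ℕ, ∀ n : ℕ, n₁ ≤ n →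
        ∃ (v : ℕ) (G : SimpleGraph (Fin v)) (Wp Wm : Finset (Fin v))
          (Vp Vm : Fin (slyM d θ n) ↪ Fin v),
          (v : ℝ) ≤ 3 * n ∧ G.maxDegree ≤ d ∧ Disjoint Wp Wm ∧
            Disjoint (Set.range Vp) (Set.range Vm) ∧
            (∀ i, G.degree (Vp i) ≤ d - 1) ∧ (∀ i, G.degree (Vm i) ≤ d - 1) ∧
            SlyPropA G lam Wp Wm n ∧
            SlyPropB G lam Wp Wm Vp Vm qp qm ((n : ℝ) ^ (-(2 * θ))) := by
  intro Δ hΔ lam hlam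
  obtain ⟨d, hd3, hdΔ, hdlam, θ, qp, qm, hθ, hθ8, hqm, hlt, hqp, hmain⟩ := h Δ hΔ lam hlam
  obtain ⟨n₁, hn₁⟩ := hmain (1 / 2) (by norm_num)
  refine ⟨d, hd3, hdΔ, hdlam, θ, qp, qm, hθ, hθ8, hqm, hlt, hqp, n₁, fun n hn => ?_⟩
  obtain ⟨v, G, Wp, Wm, Vp, Vm, hv, hdeg, hW, hVV, hdp, hdm, hA, hB, -⟩ := hn₁ n hn
  exact ⟨v, G, Wp, Wm, Vp, Vm, hv, hdeg, hW, hVV, hdp, hdm, hA, hB⟩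

/-- **S2 — LINEAR-radius, bounded-occurrence, far-from-satisfiable 3-XOR systems of every size (the card's first
lemma `exists_linearGapSystem`, sharpened by triage r1-2/r1-3: occurrence control + counting AFTER pruning).** There
are absolute constants `D` (occurrence colours), `c` (`m ≤ c·nv`), `η > 0` (far fraction) and `γ > 0` (radius rate)
such that for every `n₀` there is a system of `m` equations `x_{E e 0} + x_{E e 1} + x_{E e 2} = b e` on `nv ≥ n₀`
variables with three DISTINCT variables per equation, `nv ≤ m ≤ c·nv`, a labelling `loc` of the occurrences injective
on the occurrences of each variable (so occurrence `≤ D`), `(s, 1/2)`-BOUNDARY EXPANSION `|T| ≤ 2|∂T|` for all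
`|T| ≤ s` at LINEAR radius `s ≥ γ·nv` (the hypothesis shape of `XorSystem.good_empty/good_extend` with `q = 1`,
`p = 2`), and a right-hand side `b` that is `t`-FAR with `t ≥ η m`: every total assignment violates `≥ t` equations.
Why true — PROVABLE NOW, every ingredient is PROVED in the tree (pattern: the first half of
`SparseOrData.exists_data`, `Literature/ModelTheory/FiniteModelTheory/SparseOrData.lean`): for `u ≥ 1` put
`t' := 1728⁴·u`, `n := 192 t'`, `m := 768 t' = 4n`; `Xor3Gap.exists_threeUniformExpander (c := 4) (s := 192 u)`
(Atserias–Dawar 2019 Lemma 5 by counting; hypotheses `m ≤ 4n`, `3 ≤ n`, `s·(432·4)⁴ ≤ n` hold with equality in the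
last) gives `F : Fin m → Finset (Fin n)`, `|F u| = 3`, with `7|T| ≤ 4|N_F(T)|` for `|T| ≤ s`; split every variable
into blocks of `48` occurrences (`SparseOrData.splitScope F 48`: `splitDeg_le` occurrence `≤ 48 =: D`,
`card_splitScope = 3`, `card_biUnion_le_card_biUnion_split` expansion inherited, `le_card_splitVar`/`card_splitVar_le`:
`n ≤ nv ≤ n + 3m/48 = 240 t'`, so `nv ≤ m ≤ 4·nv`, `c := 4`); `Xor3Gap.card_le_two_mul_card_boundary` turns
`7|T| ≤ 4|N(T)|` into `|T| ≤ 2|∂T|`; `SparseOrData.exists_far (p := 2)` with `SparseOrData.far_ineq` (`2^{nv}·2^{e}·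
Σ_{i<e} C(m,i) < 2^m`, `e = 48t'+1`) gives `b` with `≥ 48 t' + 1 ≥ m/16` violations under every assignment
(`η := 1/16`); and `γ·nv ≤ γ·240·1728⁴·u = 192 u = s` for `γ := 192/(240·1728⁴)`. Remaining work is transport:
`SplitVar F 48 ≃ Fin nv` (`Fintype.equivFin`), an enumeration `Fin 3 ≃ scope` of each 3-element split scope
(`Finset.orderIsoOfFin` after transport, giving `E e` injective with `lgScope E e =` the transported scope, so
`XorSystem.boundary (lgScope E)` and the violation counts `Σ_i f (E e i) = Σ_{v ∈ scope} f v` are literally those of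
the split system), and `loc (e, i) := ⟨rank of e among the equations containing E e i, < 48⟩`
(`SparseOrData.rank`, `rank_injOn`, `splitDeg_le`). The card's own source (`exists_boundaryExpander`, rate 1/2, NO
occurrence bound) is thereby replaced, answering triage r1-2's and r1-3(b)'s sharpenings. Size M (finite
combinatorics and transport; no probability left to do). -/
theorem stub_linearSystems : ∃ (D c : ℕ) (η γ : ℝ), 0 < η ∧ 0 < γ ∧ ∀ n₀ : ℕ,
    ∃ (nv m t s : ℕ) (E : Fin m → Fin 3 → Fin nv) (loc : Fin m × Fin 3 → Fin D) (b : Fin m → ZMod 2),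
      n₀ ≤ nv ∧ nv ≤ m ∧ m ≤ c * nv ∧ (∀ e, Function.Injective (E e)) ∧
      (∀ p p' : Fin m × Fin 3, E p.1 p.2 = E p'.1 p'.2 → loc p = loc p' → p = p') ∧
      γ * nv ≤ s ∧
      (∀ T : Finset (Fin m), T.card ≤ s →
        T.card ≤ 2 * (Literature.ModelTheory.FiniteModelTheory.XorSystem.boundary (lgScope E) T).card) ∧
      η * m ≤ t ∧
      ∀ f : Fin nv → ZMod 2, t ≤ (Finset.univ.filter fun e : Fin m => ∑ i : Fin 3, f (E e i) ≠ b e).card := by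
  sorry

/-- **S3 — Duplicator (CFI gauge + local consistency; Atserias–Dawar 2019 Lemma 3.2 in the abstract form
`ckEquiv_of_consistencyFamily`; VERBATIM 2720's `stub_duplicator`).** On an `(s, q/p)`-boundary expander with
`2pK₀ ≤ qs` and `3k ≤ K₀`, the literal-gadget graphs of ANY right-hand side `b` and of `0` are `≡_{C^k}` — for every
gadget, wiring and occurrence labelling. Why true: the flip `lgFlipFun E f` (an involution) is an isomorphism
`lgGraph E loc W b ≅ lgGraph E loc W (b + ∂f)`, `(∂f) e = Σ_i f (E e i)`: pair edges join `(x,a,y)`, `(x,a+1,y)`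
(invariant), end–copy edges use the slot `(loc(e,i), j)` on both sides and shift `a` by the same `f (E e i)`,
inner–end adjacency `bit (b e) S' i = a` becomes `bit (b e + ∂f e) (S' + f∘E e∘castSucc) i = a + f (E e i)`
(`CFIMatching.bit_shift` pattern; `E e` injective so `∂f e = Σ_{v ∈ lgScope E e} f v`); so with data `lgData E`
(`|D x| ≤ c₀ = 3`, `card_lgData_le`), `isLocalFlipAction_lgFlip` (PROVED above), the consistency family
`XorSystem.Good (lgScope E) b s` with bound `K₀` (`CountingWidthXorHam.isConsistencyFamily_good hq hexp hK₀`, PROVED)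
and the compatibility clause reduced to `∂f e = b e` whenever `lgScope E e ⊆ dom` (`XorSystem.Good.sum_scope_eq`,
`hs`), `ckEquiv_of_consistencyFamily` gives the claim. Used here with `q = 1`, `p = 2`, `K₀ = 3k`, `12k ≤ s`: LINEAR
depth. Size M (the `CountingWidthXorHam.ckEquiv_padGraph` / landed `PhaseTwinsPolyDepthTwinsAboveDuplicator`
pattern, ~150 lines). -/
theorem stub_duplicator (E : Fin m → Fin 3 → Fin nv) (hE : ∀ e, Function.Injective (E e))
    (loc : Fin m × Fin 3 → Fin D) (W : LWiring v P κ₁ D K) (b : Fin m → ZMod 2) {s p q K₀ k : ℕ}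
    (hs : 1 ≤ s) (hq : 0 < q)
    (hexp : ∀ T : Finset (Fin m), T.card ≤ s →
      q * T.card ≤ p * (Literature.ModelTheory.FiniteModelTheory.XorSystem.boundary (lgScope E) T).card)
    (hK₀ : 2 * p * K₀ ≤ q * s) (hk : 3 * k ≤ K₀) :
    CkEquiv k (lgGraph E loc W 0) (lgGraph E loc W b) := by
  sorry

/-- **S4 — degree bound (VERBATIM 2720's `stub_maxDegree`).** If the gadget has maximum degree `≤ d ≤ Δ`, disjoint
port ranges and port degrees `≤ d − 1`, and `loc` is injective on the occurrences of each variable, then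
`lgGraph E loc W b` has maximum degree `≤ Δ` (`Δ ≥ 3`): a port receives at most ONE extra edge (slots are injective:
a pair slot meets its single partner in the other literal gadget, an end slot `(ℓ, j)` of `g_{x,a}` meets the single
end `(e, j, i, a)` with `E e i = x`, `loc (e, i) = ℓ`; `hVV` forbids a port being both a `V⁺` end-slot port and a
`V⁻` pair-slot port), end vertices have degree `1 + 2` (for each `i` exactly two `S'` solve `bit (b e) S' i = a`),
inner vertices degree `3`. Why true: case analysis on `lgRel` exactly as the LANDED sibling proof
`Theorems/PhaseTwinsPolyDepthTwinsAboveMaxDegree.lean` (`degree_copy_le`/`degree_end_le`/`degree_inner_le`,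
`card_filter_bit_le`). Size S–M. -/
theorem stub_maxDegree {Δ d : ℕ} (E : Fin m → Fin 3 → Fin nv) (loc : Fin m × Fin 3 → Fin D)
    (hloc : ∀ p p' : Fin m × Fin 3, E p.1 p.2 = E p'.1 p'.2 → loc p = loc p' → p = p')
    (W : LWiring v P κ₁ D K) (b : Fin m → ZMod 2) (hΔ : 3 ≤ Δ) (hd : d ≤ Δ) (hG : W.G.maxDegree ≤ d)
    (hVV : Disjoint (Set.range W.Vp) (Set.range W.Vm))
    (hdp : ∀ i, W.G.degree (W.Vp i) ≤ d - 1) (hdm : ∀ i, W.G.degree (W.Vm i) ≤ d - 1) :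
    (lgGraph E loc W b).maxDegree ≤ Δ := by
  sorry

/-- **S5 — the copy-explicit connector sandwich (Sly's Lemma 2.2 for the literal-gadget wiring at CONSTANT gadget
error; HARDEST provable-now stub; VERBATIM 2720's `stub_connector`).** For ANY gadget with `(GpropA)` at `n ≥ 1` and
`(GpropB)` with error `δ ∈ [0, 1]`, any system, right-hand side and occurrence labelling injective on the occurrences
of each variable, `LGCutEstimate` holds: `(phaseProbs)` because on `lgBase` the `2nv` literal gadgets are independent
and the `10mK` complex vertices isolated, `Z_base(Y) = Π_g Z_G(Y_g)·(1+λ)^{10mK} ≥ (Z_G/n)^{2nv}(1+λ)^{10mK}`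
(`phaseProbs_of_slyPropA` pattern); `(cutProb)` because, grouping the independent sets of `lgGraph` with phase vector
`Y` by the family of port configurations of the copies, `Z_{𝔊}(Y) = Σ_{(S_g)} [Π_g Z_G(Y_g ∧ σ_V = S_g)]·Wt((S_g))`
with `Wt ≥ 0` (pair-edge indicators times, per complex, `Σ_{J indep} λ^{|J|} Π_{ends ∈ J}[port vacant]`),
`(GpropB)` bounds each bracket termwise by `(1±δ)^{2nv} Π_g Q^{Y_g}(S_g) Z_G(Y_g)` (`cutProb_bounds_of_slyPropB`
pattern — POINTWISE ratio form, so valid for every `nv`: this is where the route's recorded reason for #3 being open,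
"GŠV gadgets grow like `n^θ`, gap `e^{o(n)}`", dissolves), and under the product measure the expectation FACTORISES
over variables and complexes because they use pairwise distinct ports (`slot` injective, `Vp`/`Vm` disjoint
embeddings, `hloc`): `E[Wt] = Π_x pairW · Π_e (cxWeight)^K` (`sum_bernoulliWeight_noPair`,
`sum_bernoulliWeight_superset`; the landed `PhaseTwinsPolyDepthTwinsAboveConnectorFibres.lean` toolkit —
`sum_bw_marginal`, `sum_bw_prod_split`, `bw_eq_prod_fib` — was written for exactly this bookkeeping), i.e.
`lgW b Y · (1+λ)^{10mK}`. Degenerate instances (Disproof §4b style): `m = 0`/`K = 0` (no complexes), `κ₁ = 0` (no pair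
edges), `nv = 0` (one empty phase vector), `λ = 0` (then `SlyPropA` at `n ≥ 1` is unsatisfiable: vacuous) all hold.
Size L (adapt `hardcoreZOn_gadgetSubst_phaseVec_eq_sum`, `sum_patterns_portLaw`, `cutProb_bounds_of_slyPropB`,
`phaseProbs_of_slyPropA`, `SlyPropB.restrict`). -/
theorem stub_connector (E : Fin m → Fin 3 → Fin nv) (loc : Fin m × Fin 3 → Fin D)
    (hloc : ∀ p p' : Fin m × Fin 3, E p.1 p.2 = E p'.1 p'.2 → loc p = loc p' → p = p')
    (W : LWiring v P κ₁ D K) {lam qp qm δ : ℝ} (hlam : 0 ≤ lam) (hqm : 0 < qm) (hlt : qm < qp)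
    (hqp : qp < 1) (hδ0 : 0 ≤ δ) (hδ1 : δ ≤ 1) {n : ℕ} (hn : 0 < n)
    (hVV : Disjoint (Set.range W.Vp) (Set.range W.Vm))
    (hA : SlyPropA W.G lam W.Wp W.Wm n) (hB : SlyPropB W.G lam W.Wp W.Wm W.Vp W.Vm qp qm δ)
    (b : Fin m → ZMod 2) : LGCutEstimate E loc W lam qp qm δ n b := by
  sorry

/-- **S6 — the sector optimisation with LOCAL accounting (the card's `log_ratio_ge_of_energy_gap` made honest;
2720's `stub_energy` part (ii), with the contrast as hypothesis `hΨ` — part (i) `Ψ1 < Ψ0` is LANDED as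
`ParityWiredPorts.stub_chargeVisible` and is fed in by the composition).** For `λ > 0`, `0 < q⁻ < q⁺ < 1`,
`Ψ1 ≤ Ψ0`: if every variable occurs in `≤ D` (equation, position) pairs, every assignment violates `≥ t` equations of
`(E, b)`, and the pair coupling dominates (`K·D·log ρ_F ≤ κ₁·log B`, `ρ_F = cxRho`, `B = slyB`), then EVERY phase
vector `Y` of the far twin weighs at most `e^{−K t (Ψ0−Ψ1)}` times the reference vector of the satisfiable twin:
`lgW b Y · e^{K t (Ψ0 − Ψ1)} ≤ lgW 0 lgRef`. Why true: let `A` be the ALIGNED variables (`Y(x,0) = Y(x,1)`) and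
`h x := [Y(x,0) = −]`; pair factors: anti-aligned `(1−q⁺q⁻)^{2κ₁}` for both orientations, aligned `= anti · B^{−κ₁}`
(`one_lt_slyB`); reference: `lgW 0 ref = anti^{nv} · e^{K m Ψ0}` (`cxW 0 ref = e^{Ψ0}` by `cxW_pos`). An equation `e`
untouched by `A` has factor `cxW (b e) (ref shifted by h on its legs) = e^{Ψ(b e + Σ_i h(E e i))}` (TSEITIN
COVARIANCE of the complex: `(i,a) ↦ (i, a + g i)`, `S' ↦ S' + g|₂` is an isomorphism `cxGraph e ≅ cxGraph (e + Σ g)`,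
the `bit_shift` identity; one leg is the landed `Negative.cxWeight_one_eq`/Disproof §4c `cxWeight_one_eq`), i.e. `e^{Ψ0}`
if `h` satisfies `e` and `e^{Ψ1}` otherwise. A TOUCHED equation has factor `≤ F_max = cxW · (all −)`
(`cxW_le_allMinus`, charge-blind by `cxW_const_eq`) and — the one non-obvious step — `F_max = ρ_F · F_min ≤ ρ_F · e^{Ψ1}`
because `F_min = cxW 0 (all +) ≤ cxW 1 ref` (`cxWeight_one_eq` turns `cxW 1 ref` into `cxW 0` at a vacancy pattern that
dominates all-`+` coordinatewise; `cxWeight_mono`). Hence, with `T_A` the touched equations (`|T_A| ≤ D|A|` by `hocc`)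
and `V` the equations violated by `h`, `|V| ≥ t`:
`lgW b Y ≤ anti^{nv} B^{−κ₁|A|} · e^{KΨ0·#(untouched ∖ V)} · e^{KΨ1·#(untouched ∩ V)} · (ρ_F e^{Ψ1})^{K|T_A|}`
`= lgW 0 ref · B^{−κ₁|A|} ρ_F^{K|T_A|} e^{−K(Ψ0−Ψ1)(#(untouched ∩ V) + |T_A|)} ≤ lgW 0 ref · e^{−K t (Ψ0−Ψ1)} ·
(B^{−κ₁} ρ_F^{KD})^{|A|}`, and the bracket is `≤ 1` by `hcouple` — NO `+g` term and NO dependence on `m` in the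
coupling (this is Disproof §5(3b)'s "local temptation", and why 2720's sector inequality suffices as typed).
Degenerate instances checked (planner): `t = 0` (claim `lgW b Y ≤ lgW 0 ref` for all `b, Y` — true by the same
accounting), `K = 0`, `κ₁ = 0` (then `hcouple` forces `D = 0` or is false, since `ρ_F > 1` for `q⁻ < q⁺`, `λ > 0`),
`m = 0`, `nv = 0`, repeated variables inside an equation (covariance is leg-wise) — all fine. Size M (finite
combinatorics + `Finset.prod` inequalities; helpers `cxW_pos`, `cxW_le_allMinus`, `cxW_const_eq`, `cxWeight_mono`,
`cxWeight_one_eq` are kernel-checked in `Cruxes/PolyDepthTwinsAbove/Disproof.lean` §4c / proposed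
`Negative/TseitinGapCoupling.lean`). -/
theorem stub_energy {lam qp qm : ℝ} (hlam : 0 < lam) (hqm : 0 < qm) (hlt : qm < qp) (hqp : qp < 1)
    (hΨ : pwPsi lam qp qm 1 ≤ pwPsi lam qp qm 0)
    {nv m D K κ₁ : ℕ} (E : Fin m → Fin 3 → Fin nv)
    (hocc : ∀ x : Fin nv, (Finset.univ.filter fun p : Fin m × Fin 3 => E p.1 p.2 = x).card ≤ D)
    (b : Fin m → ZMod 2) (t : ℕ)
    (hfar : ∀ f : Fin nv → ZMod 2,
      t ≤ (Finset.univ.filter fun e : Fin m => ∑ i : Fin 3, f (E e i) ≠ b e).card)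
    (hcouple : (K * D : ℝ) * Real.log (cxRho lam qp qm) ≤ κ₁ * Real.log (slyB qp qm))
    (Y : Fin nv × ZMod 2 → Bool) :
    lgW E lam qp qm κ₁ K b Y * Real.exp (K * t * (pwPsi lam qp qm 0 - pwPsi lam qp qm 1)) ≤
      lgW E lam qp qm κ₁ K 0 lgRef := by
  sorry

/-- **S7 — the parameter regime is nonempty (asymptotic arithmetic at ONE gadget size; VERBATIM 2720's
`stub_parameters`).** For `θ > 0`, `d ≥ 3`, constants `D`, `η, g, L_B > 0`, any `L_ρ` and any threshold `N₀` there
are a gadget size `n ≥ N₀` and numbers `K ≥ 1`, `κ₁` with: enough ports (`κ₁ + D·K ≤ slyM d θ n`), the sector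
inequality (`K·D·L_ρ ≤ κ₁·L_B`), small gadget error (`n^{−2θ} ≤ 1/2`) and the per-variable budget
`1 + 2 log(3n) ≤ K·η·g` (gain `K η g` per variable beats phase entropy `2 log n` + sandwich loss `2 log 3` + the rate
`1`). Why true: take `K := ⌈(1 + 2 log 3n)/(ηg)⌉`, `κ₁ := ⌈K D max(L_ρ,0)/L_B⌉`, both `O(log n)`, while
`slyM d θ n = (d−1)^{⌊θ log_{d−1} n⌋} ≥ n^θ/(d−1)` and `log n = o(n^θ)` (`isLittleO_log_rpow_atTop`;
cf. `mul_slyK_le_slyM` for the `slyM` lower bound); it cannot fail, but it is where the (astronomical,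
`(Δ,λ)`-dependent) constant gadget size is fixed — the card's honest price (`n ≈ 10^{50}` at `(3, 5)`; irrelevant for
`∃`). Size M (rpow/log/floor bookkeeping in the style of `eventually_mul_rpow_rpow_le_slyB_pow`). -/
theorem stub_parameters {θ : ℝ} (hθ : 0 < θ) {d : ℕ} (hd : 3 ≤ d) (D : ℕ) {η g LB : ℝ} (hη : 0 < η)
    (hg : 0 < g) (hLB : 0 < LB) (Lρ : ℝ) (N₀ : ℕ) :
    ∃ n K κ₁ : ℕ, N₀ ≤ n ∧ 0 < n ∧ 1 ≤ K ∧
      Fintype.card (Fin κ₁ ⊕ (Fin D × Fin K)) ≤ slyM d θ n ∧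
      (K * D : ℝ) * Lρ ≤ κ₁ * LB ∧
      (n : ℝ) ^ (-(2 * θ)) ≤ 1 / 2 ∧
      1 + 2 * Real.log (3 * n) ≤ K * η * g := by
  sorry

/-! ## Proved glue -/

/-- The weights are nonnegative (`λ ≥ 0`, `q± ∈ [0, 1]`). -/
theorem lgW_nonneg (E : Fin m → Fin 3 → Fin nv) {lam qp qm : ℝ} (hlam : 0 ≤ lam) (hqm0 : 0 ≤ qm)
    (hqm1 : qm ≤ 1) (hqp0 : 0 ≤ qp) (hqp1 : qp ≤ 1) (κ₁ K : ℕ) (b : Fin m → ZMod 2)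
    (Y : Fin nv × ZMod 2 → Bool) : 0 ≤ lgW E lam qp qm κ₁ K b Y := by
  have hocc : ∀ s, 0 ≤ occP qp qm s ∧ occP qp qm s ≤ 1 ∧ 0 ≤ occM qp qm s ∧ occM qp qm s ≤ 1 := by
    intro s; cases s <;> simp [occP, occM] <;> refine ⟨?_, ?_, ?_, ?_⟩ <;> assumption
  unfold lgW
  refine mul_nonneg (Finset.prod_nonneg fun x _ => ?_) (Finset.prod_nonneg fun e _ => pow_nonneg ?_ _)
  · unfold pairW
    refine pow_nonneg (mul_nonneg ?_ ?_) _
    · obtain ⟨h1, h2, -, -⟩ := hocc (Y (x, 0))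
      obtain ⟨h3, h4, -, -⟩ := hocc (Y (x, 1))
      nlinarith [mul_le_one₀ h2 h3 h4]
    · obtain ⟨-, -, h1, h2⟩ := hocc (Y (x, 0))
      obtain ⟨-, -, h3, h4⟩ := hocc (Y (x, 1))
      nlinarith [mul_le_one₀ h2 h3 h4]
  · unfold cxW cxWeight
    refine div_nonneg (Finset.sum_nonneg fun J _ => ?_) (pow_nonneg (by linarith) _)
    split_ifs
    · refine mul_nonneg (pow_nonneg hlam _) (Finset.prod_nonneg fun p _ => ?_)
      split_ifs
      · obtain ⟨-, h2, -, -⟩ := hocc (Y (E e p.1, p.2))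
        linarith
      · exact zero_le_one
    · exact le_rfl

/-- A labelling injective on the occurrences of each variable bounds the occurrence numbers by `D`. -/
theorem occ_le_of_loc (E : Fin m → Fin 3 → Fin nv) (loc : Fin m × Fin 3 → Fin D)
    (hloc : ∀ p p' : Fin m × Fin 3, E p.1 p.2 = E p'.1 p'.2 → loc p = loc p' → p = p') (x : Fin nv) :
    (Finset.univ.filter fun p : Fin m × Fin 3 => E p.1 p.2 = x).card ≤ D := by
  have h := Finset.card_le_card_of_injOn loc
    (s := Finset.univ.filter fun p : Fin m × Fin 3 => E p.1 p.2 = x) (t := Finset.univ)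
    (fun p _ => Finset.mem_univ _) (fun p hp p' hp' hpp => by
      have hp1 : E p.1 p.2 = x := (Finset.mem_filter.1 (Finset.mem_coe.1 hp)).2
      have hp2 : E p'.1 p'.2 = x := (Finset.mem_filter.1 (Finset.mem_coe.1 hp')).2
      exact hloc p p' (hp1.trans hp2.symm) hpp)
  simpa using h

/-- **Sly's proof of Theorem 1 run for the two right-hand sides** (PROVED): from the two `LGCutEstimate`s
(error `δ ≤ 1/2`), the weight gap `lgW b Y · T ≤ lgW 0 ref` and `R · (3n)^{2nv} ≤ T`:
`R · Z(𝔊_b) ≤ Z(𝔊₀)`. Upper bound: `Z(𝔊_b) = Σ_Y Z_{𝔊_b}(Y) ≤ (1+δ)^{2nv} (W₀/T) Σ_Y Z_base(Y) =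
(1+δ)^{2nv} (W₀/T) Z_base` — the sum over ALL phase vectors of the base weights is `Z_base`, so NO `4^{nv}`
entropy term appears; lower bound: `Z(𝔊₀) ≥ Z_{𝔊₀}(ref) ≥ (1−δ)^{2nv} W₀ n^{−2nv} Z_base`; and
`(1+δ) ≤ 3(1−δ)`. -/
theorem twins_of_estimates (E : Fin m → Fin 3 → Fin nv) (loc : Fin m × Fin 3 → Fin D)
    (W : LWiring v P κ₁ D K) {lam qp qm δ : ℝ} (hlam : 0 ≤ lam) (hδ0 : 0 ≤ δ) (hδ : δ ≤ 1 / 2)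
    {n : ℕ} (hn : 0 < n) (b : Fin m → ZMod 2) (hWnn : ∀ Y, 0 ≤ lgW E lam qp qm κ₁ K b Y)
    (h0 : LGCutEstimate E loc W lam qp qm δ n 0) (hb : LGCutEstimate E loc W lam qp qm δ n b)
    {T R : ℝ} (hT : 0 < T) (hR : 0 ≤ R)
    (hgap : ∀ Y, lgW E lam qp qm κ₁ K b Y * T ≤ lgW E lam qp qm κ₁ K 0 lgRef)
    (hRT : R * (3 * (n : ℝ)) ^ (2 * nv) ≤ T) :
    R * independencePolynomial (lgGraph E loc W b) lam ≤ independencePolynomial (lgGraph E loc W 0) lam := by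
  set Zb : (Fin nv × ZMod 2 → Bool) → ℝ :=
    fun Y => hardcoreZOn (lgBase nv m W) lam (fun I => lgPhase W I = Y) with hZb
  set W0 : ℝ := lgW E lam qp qm κ₁ K 0 lgRef with hW0
  set Wb : (Fin nv × ZMod 2 → Bool) → ℝ := lgW E lam qp qm κ₁ K b with hWb
  set Zbase : ℝ := independencePolynomial (lgBase nv m W) lam with hZbase
  have hnR : (0 : ℝ) < n := by exact_mod_cast hn
  have hZb0 : ∀ Y, 0 ≤ Zb Y := fun Y => hardcoreZOn_nonneg _ hlam _
  have hZbase0 : 0 ≤ Zbase := (independencePolynomial_pos _ hlam).le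
  have hW00 : 0 ≤ W0 := by
    have h1 := hgap lgRef
    have h2 : 0 ≤ Wb lgRef * T := mul_nonneg (hWnn lgRef) hT.le
    exact h2.trans h1
  -- upper bound for `b`
  have hup : independencePolynomial (lgGraph E loc W b) lam ≤ (1 + δ) ^ (2 * nv) * (W0 / T) * Zbase := by
    rw [hZbase, ← sum_hardcoreZOn_fiber (lgGraph E loc W b) lam (lgPhase W),
      ← sum_hardcoreZOn_fiber (lgBase nv m W) lam (lgPhase W), Finset.mul_sum]
    refine Finset.sum_le_sum fun Y _ => ?_
    have h1 := (hb Y).2.2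
    have h2 : Wb Y ≤ W0 / T := by
      rw [le_div_iff₀ hT]; exact hgap Y
    have h1δ : 0 ≤ (1 + δ) ^ (2 * nv) := pow_nonneg (by linarith) _
    calc hardcoreZOn (lgGraph E loc W b) lam (fun I => lgPhase W I = Y)
        ≤ (1 + δ) ^ (2 * nv) * (Wb Y * Zb Y) := h1
      _ ≤ (1 + δ) ^ (2 * nv) * (W0 / T * Zb Y) :=
          mul_le_mul_of_nonneg_left (mul_le_mul_of_nonneg_right h2 (hZb0 Y)) h1δ
      _ = (1 + δ) ^ (2 * nv) * (W0 / T) * Zb Y := by ring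
  -- lower bound for `0`
  have hlo : (1 - δ) ^ (2 * nv) * W0 * (((n : ℝ) ^ (2 * nv))⁻¹ * Zbase) ≤
      independencePolynomial (lgGraph E loc W 0) lam := by
    have h1 := (h0 lgRef).2.1
    have h2 := (h0 lgRef).1
    have h1δ : 0 ≤ (1 - δ) ^ (2 * nv) := pow_nonneg (by linarith) _
    calc (1 - δ) ^ (2 * nv) * W0 * (((n : ℝ) ^ (2 * nv))⁻¹ * Zbase)
        ≤ (1 - δ) ^ (2 * nv) * W0 * Zb lgRef := mul_le_mul_of_nonneg_left h2 (mul_nonneg h1δ hW00)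
      _ = (1 - δ) ^ (2 * nv) * (W0 * Zb lgRef) := by ring
      _ ≤ hardcoreZOn (lgGraph E loc W 0) lam (fun I => lgPhase W I = lgRef) := h1
      _ ≤ independencePolynomial (lgGraph E loc W 0) lam := hardcoreZOn_le_independencePolynomial _ hlam _
  -- combine
  have hpow3 : (1 + δ) ^ (2 * nv) ≤ (3 * (1 - δ)) ^ (2 * nv) :=
    pow_le_pow_left₀ (by linarith) (by linarith) _
  have hWT : 0 ≤ W0 / T := div_nonneg hW00 hT.le
  have hn2 : (0 : ℝ) < (n : ℝ) ^ (2 * nv) := pow_pos hnR _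
  have hX : 0 ≤ (1 - δ) ^ (2 * nv) * W0 * (((n : ℝ) ^ (2 * nv))⁻¹ * Zbase) := by
    have h1δ : 0 ≤ (1 - δ) ^ (2 * nv) := pow_nonneg (by linarith) _
    positivity
  calc R * independencePolynomial (lgGraph E loc W b) lam
      ≤ R * ((1 + δ) ^ (2 * nv) * (W0 / T) * Zbase) := mul_le_mul_of_nonneg_left hup hR
    _ ≤ R * ((3 * (1 - δ)) ^ (2 * nv) * (W0 / T) * Zbase) := by
        refine mul_le_mul_of_nonneg_left ?_ hR
        exact mul_le_mul_of_nonneg_right (mul_le_mul_of_nonneg_right hpow3 hWT) hZbase0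
    _ = (R * (3 * (n : ℝ)) ^ (2 * nv) / T) *
          ((1 - δ) ^ (2 * nv) * W0 * (((n : ℝ) ^ (2 * nv))⁻¹ * Zbase)) := by
        rw [mul_pow, mul_pow]
        field_simp
    _ ≤ 1 * ((1 - δ) ^ (2 * nv) * W0 * (((n : ℝ) ^ (2 * nv))⁻¹ * Zbase)) := by
        refine mul_le_mul_of_nonneg_right ?_ hX
        rwa [div_le_one hT]
    _ = (1 - δ) ^ (2 * nv) * W0 * (((n : ℝ) ^ (2 * nv))⁻¹ * Zbase) := one_mul _
    _ ≤ independencePolynomial (lgGraph E loc W 0) lam := hlo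

/-- **The budget arithmetic, exponential form** (PROVED): the per-variable budget `1 + 2 log(3n) ≤ K η g` of S7 with
`nv ≤ m` and `η m ≤ t` gives `e^{nv} · (3n)^{2nv} ≤ e^{K t g}` — the LINEAR log-gap of the card. -/
theorem budget_exp {n K nv m t : ℕ} {η g : ℝ} (hn : 0 < n) (hη : 0 ≤ η) (hg : 0 ≤ g)
    (hbudget : 1 + 2 * Real.log (3 * n) ≤ K * η * g) (hnvm : nv ≤ m) (htη : η * m ≤ t) :
    Real.exp (nv : ℝ) * (3 * (n : ℝ)) ^ (2 * nv) ≤ Real.exp (K * t * g) := by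
  have hnR : (0 : ℝ) < n := by exact_mod_cast hn
  have h3n : (0 : ℝ) < 3 * n := by positivity
  have hpow : (3 * (n : ℝ)) ^ (2 * nv) = Real.exp (2 * nv * Real.log (3 * n)) := by
    rw [show (2 * nv * Real.log (3 * n) : ℝ) = ((2 * nv : ℕ) : ℝ) * Real.log (3 * n) by push_cast; ring,
      Real.exp_nat_mul, Real.exp_log h3n]
  rw [hpow, ← Real.exp_add, Real.exp_le_exp]
  have hKg : (0 : ℝ) ≤ K * g := mul_nonneg (Nat.cast_nonneg K) hg
  have hnvm' : (nv : ℝ) ≤ m := by exact_mod_cast hnvm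
  have hnv0 : (0 : ℝ) ≤ nv := Nat.cast_nonneg nv
  calc (nv : ℝ) + 2 * nv * Real.log (3 * n) = nv * (1 + 2 * Real.log (3 * n)) := by ring
    _ ≤ nv * (K * η * g) := mul_le_mul_of_nonneg_left hbudget hnv0
    _ = K * g * (η * nv) := by ring
    _ ≤ K * g * (η * m) := mul_le_mul_of_nonneg_left (mul_le_mul_of_nonneg_left hnvm' hη) hKg
    _ ≤ K * g * t := mul_le_mul_of_nonneg_left htη hKg
    _ = K * t * g := by ring

/-- The independence polynomial is invariant under transport along a bijection of the vertices. -/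
theorem independencePolynomial_map_equiv {α β : Type*} [Fintype α] [DecidableEq α] [Fintype β]
    [DecidableEq β] (G : SimpleGraph α) (e : α ≃ β) (lam : ℝ) :
    independencePolynomial (G.map e.toEmbedding) lam = independencePolynomial G lam := by
  have hadj : ∀ a b : α, (G.map e.toEmbedding).Adj (e.toEmbedding a) (e.toEmbedding b) ↔ G.Adj a b :=
    fun a b => SimpleGraph.map_adj_apply
  have hind : ∀ I : Finset α,
      (G.map e.toEmbedding).IsIndepSet (↑(I.map e.toEmbedding) : Set β) ↔ G.IsIndepSet (↑I : Set α) := by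
    intro I
    constructor
    · intro h a ha b hb hab
      have hab' : e.toEmbedding a ≠ e.toEmbedding b := fun h' => hab (e.injective h')
      have := h (Finset.mem_coe.2 (Finset.mem_map_of_mem _ (Finset.mem_coe.1 ha)))
        (Finset.mem_coe.2 (Finset.mem_map_of_mem _ (Finset.mem_coe.1 hb))) hab'
      exact fun hG => this ((hadj a b).2 hG)
    · intro h x hx y hy hxy
      obtain ⟨a, ha, rfl⟩ := Finset.mem_map.1 (Finset.mem_coe.1 hx)
      obtain ⟨b, hb, rfl⟩ := Finset.mem_map.1 (Finset.mem_coe.1 hy)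
      exact fun hG => h (Finset.mem_coe.2 ha) (Finset.mem_coe.2 hb) (fun hab => hxy (by rw [hab]))
        ((hadj a b).1 hG)
  unfold independencePolynomial
  symm
  refine Fintype.sum_equiv (Equiv.finsetCongr e) _ _ fun I => ?_
  rw [Equiv.finsetCongr_apply, Finset.card_map]
  by_cases hI : G.IsIndepSet (↑I : Set α)
  · rw [if_pos hI, if_pos ((hind I).2 hI)]
  · rw [if_neg hI, if_neg (fun h => hI ((hind I).1 h))]

/-- Transport of a degree bound along an isomorphism, for ANY decidability instances (the crux statements
carry the classical ones). -/
theorem maxDegree_le_of_iso {α β : Type*} [Fintype α] [Fintype β] {G : SimpleGraph α} {H : SimpleGraph β}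
    {iG : DecidableRel G.Adj} {iH : DecidableRel H.Adj} (f : G ≃g H) {Δ : ℕ}
    (h : @SimpleGraph.maxDegree α G _ iG ≤ Δ) : @SimpleGraph.maxDegree β H _ iH ≤ Δ := by
  have := f.maxDegree_eq
  rw [← this]; exact h

/-- The route's inlined sum IS `independencePolynomial`, for ANY decidability instances. -/
theorem indepSum_eq {α : Type*} [Fintype α] [DecidableEq α] (G : SimpleGraph α) {iG : DecidableRel G.Adj}
    {dI : ∀ I : Finset α, Decidable (G.IsIndepSet (↑I : Set α))} (lam : ℝ) :
    (∑ I : Finset α, @ite ℝ (G.IsIndepSet (↑I : Set α)) (dI I) (lam ^ I.card) 0) =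
      @independencePolynomial α _ _ G iG ℝ _ lam := by
  unfold independencePolynomial
  exact Finset.sum_congr rfl fun I _ => by congr

/-- The number of vertices of the literal-gadget graph. -/
theorem card_LGVert (nv m v K : ℕ) : Fintype.card (LGVert nv m v K) = 2 * nv * v + 10 * m * K := by
  simp only [LGVert, Fintype.card_sum, Fintype.card_prod, Fintype.card_fin, ZMod.card, Fintype.card_fun]
  ring

/-! ## The composition (kernel-checked, no `sorry` of its own)

Stubs ⇒ `linearGapTwins` (the card's transfer target C⁺ = `LinearDepthMacroscopicTwins`, in explicit-constant form)
⇒ `PolyDepthTwinsAbove_of` (the crux, BY NAME) and `macroscopicTwinsAbove_of_linearGap` (crux #3, BY NAME). -/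

/-- **C⁺ — linear-depth, linear-log-gap twins of linear size (the card's `LinearDepthMacroscopicTwins`), from the seven
stubs.** For `Δ ≥ 3` and `λ > λ_c(Δ)` there are a size constant `A` and a depth rate `γ > 0` such that for every
`n₀` there are `nv ≥ n₀`, a radius `s ≥ γ·nv`, and max-degree-`≤ Δ` graphs `G, H` on `N` vertices,
`nv ≤ N ≤ A·nv`, with `G ≡_{C^k} H` for EVERY `k ≥ 1` with `12k ≤ s` and `e^{nv} · Z_H(λ) ≤ Z_G(λ)` (the route's
inlined sums). Proof = the text of the module docstring: S1 → `d, θ, q±`; landed contrast → `g > 0`; S2 → `D, c, η, γ`;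
S7 → ONE gadget size `n` with `K, κ₁`; gadget `W`; per `n₀`: S2's system; S5 ×2 + S6 + `budget_exp` +
`twins_of_estimates` → gap; S3 → `≡_{C^k}`; S4 → degrees; transport to `Fin N`. -/
theorem linearGapTwins (Δ : ℕ) (hΔ : 3 ≤ Δ) (lam : ℝ) (hlam : hardCoreThreshold Δ < lam) :
    ∃ (A : ℕ) (γ : ℝ), 0 < γ ∧ ∀ n₀ : ℕ, ∃ (nv s N : ℕ) (G H : SimpleGraph (Fin N)),
      n₀ ≤ nv ∧ nv ≤ N ∧ N ≤ A * nv ∧ γ * nv ≤ s ∧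
      G.maxDegree ≤ Δ ∧ H.maxDegree ≤ Δ ∧
      (∀ k : ℕ, 1 ≤ k → 12 * k ≤ s → CkEquiv k G H) ∧
      Real.exp (nv : ℝ) * (∑ I : Finset (Fin N), (if H.IsIndepSet (↑I : Set (Fin N)) then lam ^ I.card else 0)) ≤
        ∑ I : Finset (Fin N), (if G.IsIndepSet (↑I : Set (Fin N)) then lam ^ I.card else 0) := by
  obtain ⟨d, hd3, hdΔ, hdlam, θ, qp, qm, hθ, hθ8, hqm, hlt, hqp, nA, hnA⟩ := stub_slyGadgets Δ hΔ lam hlam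
  have hlam0 : 0 < lam := (hardCoreThreshold_pos hd3).trans hdlam
  -- the contrast `g = Ψ0 − Ψ1 > 0` (LANDED: sibling line's `stub_chargeVisible`)
  have hvis : pwPsi lam qp qm 1 < pwPsi lam qp qm 0 :=
    Summit.PneNP.PneNP.Cruxes.PolyDepthTwinsAbove.ParityWiredPorts.stub_chargeVisible hlam0 hqm hlt hqp
  have hg : 0 < pwPsi lam qp qm 0 - pwPsi lam qp qm 1 := sub_pos.2 hvis
  have hLB : 0 < Real.log (slyB qp qm) := Real.log_pos (one_lt_slyB hqm hlt hqp)
  -- the absolute constants of the base systems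
  obtain ⟨D, c, η, γ, hη, hγ, hsys⟩ := stub_linearSystems
  -- ONE gadget size `n` and the numbers `K, κ₁`
  obtain ⟨n, K, κ₁, hnA', hn, hK1, hslots, hcouple, hδhalf, hbud⟩ :=
    stub_parameters hθ hd3 D hη hg hLB (Real.log (cxRho lam qp qm)) nA
  obtain ⟨v, G, Wp, Wm, Vp, Vm, hv, hdeg, -, hVV, hdp, hdm, hA, hB⟩ := hnA n hnA'
  let W : LWiring v (slyM d θ n) κ₁ D K := ⟨G, Wp, Wm, Vp, Vm, slotEmb hslots⟩
  have hnR : (0 : ℝ) < n := by exact_mod_cast hn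
  have hδ0 : 0 ≤ (n : ℝ) ^ (-(2 * θ)) := Real.rpow_nonneg hnR.le _
  refine ⟨2 * v + 10 * c * K, γ, hγ, fun n₀ => ?_⟩
  -- the base system with `nv ≥ n₀` variables
  obtain ⟨nv, m, t, s, E, loc, b, hn₀, hnvm, hmc, hE, hloc, hγs, hexp, htη, hfar⟩ := hsys n₀
  let X : SimpleGraph (LGVert nv m v K) := lgGraph E loc W 0
  let X' : SimpleGraph (LGVert nv m v K) := lgGraph E loc W b
  let N : ℕ := Fintype.card (LGVert nv m v K)
  have hNcard : N = 2 * nv * v + 10 * m * K := card_LGVert nv m v K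
  let e : LGVert nv m v K ≃ Fin N := Fintype.equivFin (LGVert nv m v K)
  -- the estimates
  have hcut0 : LGCutEstimate E loc W lam qp qm ((n : ℝ) ^ (-(2 * θ))) n 0 :=
    stub_connector E loc hloc W hlam0.le hqm hlt hqp hδ0 (hδhalf.trans (by norm_num)) hn hVV hA hB 0
  have hcutb : LGCutEstimate E loc W lam qp qm ((n : ℝ) ^ (-(2 * θ))) n b :=
    stub_connector E loc hloc W hlam0.le hqm hlt hqp hδ0 (hδhalf.trans (by norm_num)) hn hVV hA hB b
  have hgap : ∀ Y : Fin nv × ZMod 2 → Bool,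
      lgW E lam qp qm κ₁ K b Y * Real.exp (K * t * (pwPsi lam qp qm 0 - pwPsi lam qp qm 1)) ≤
        lgW E lam qp qm κ₁ K 0 lgRef :=
    fun Y => stub_energy hlam0 hqm hlt hqp hvis.le E (occ_le_of_loc E loc hloc) b t hfar hcouple Y
  have hRT := budget_exp (K := K) hn hη.le hg.le hbud hnvm htη
  have htwins : Real.exp (nv : ℝ) * independencePolynomial X' lam ≤ independencePolynomial X lam :=
    twins_of_estimates E loc W hlam0.le hδ0 hδhalf hn b
      (fun Y => lgW_nonneg E hlam0.le hqm.le (hlt.le.trans hqp.le) (hqm.le.trans hlt.le) hqp.le κ₁ K b Y)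
      hcut0 hcutb (Real.exp_pos _) (Real.exp_pos _).le hgap hRT
  have hdegX : X.maxDegree ≤ Δ := stub_maxDegree E loc hloc W 0 hΔ hdΔ hdeg hVV hdp hdm
  have hdegX' : X'.maxDegree ≤ Δ := stub_maxDegree E loc hloc W b hΔ hdΔ hdeg hVV hdp hdm
  refine ⟨nv, s, N, X.map e.toEmbedding, X'.map e.toEmbedding, hn₀, ?_, ?_, hγs, ?_, ?_, ?_, ?_⟩
  · -- `nv ≤ N`: `N ≥ 10 m K ≥ m ≥ nv`
    rw [hNcard]
    have h1 : m * 1 ≤ 10 * m * K := Nat.mul_le_mul (by omega) hK1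
    omega
  · -- `N ≤ (2v + 10cK) · nv`
    rw [hNcard]
    have h1 : 10 * m * K ≤ 10 * (c * nv) * K := Nat.mul_le_mul_right K (Nat.mul_le_mul_left 10 hmc)
    calc 2 * nv * v + 10 * m * K ≤ 2 * nv * v + 10 * (c * nv) * K := Nat.add_le_add_left h1 _
      _ = (2 * v + 10 * c * K) * nv := by ring
  · -- maximum degree of the first twin
    exact maxDegree_le_of_iso (SimpleGraph.Iso.map e X) hdegX
  · -- maximum degree of the second twin
    exact maxDegree_le_of_iso (SimpleGraph.Iso.map e X') hdegX'
  · -- Duplicator at every depth `k` with `12 k ≤ s` (q = 1, p = 2, K₀ = 3k)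
    intro k hk1 hks
    have hck : CkEquiv k X X' :=
      stub_duplicator E hE loc W b (s := s) (p := 2) (q := 1) (K₀ := 3 * k) (by omega) one_pos
        (fun T hT => by rw [one_mul]; exact hexp T hT) (by omega) le_rfl
    exact hck.iso_congr (SimpleGraph.Iso.map e X) (SimpleGraph.Iso.map e X')
  · -- the gap, transported to `Fin N`
    have hZ := htwins
    rw [← independencePolynomial_map_equiv X e lam, ← independencePolynomial_map_equiv X' e lam] at hZ
    convert hZ using 2 <;> exact indepSum_eq _ _

/-- **`PolyDepthTwinsAbove` from the seven stubs (via C⁺, θ = 1/2).** Given `Δ ≥ 3`, `λ > λ_c(Δ)`, take `A, γ` from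
`linearGapTwins`; for `n₀` ask for `nv ≥ n₀ + 1 + ⌈24/γ⌉ + ⌈576 A/γ²⌉`; with `k := s/12 ≥ 1` we have
`k ≥ γ·nv/24`, hence `k² ≥ γ²nv²/576 ≥ A·nv ≥ N`, i.e. `N^{1/2} ≤ k`; so every `F` of treewidth `< N^{1/2}` has
treewidth `< k` and the PROVED Dvořák bridge `Dvorak2010.homCount_eq_of_ckEquiv` converts `G ≡_{C^k} H` into equal
hom counts; finally `2 ≤ e^{nv}`. -/
theorem PolyDepthTwinsAbove_of : PolyDepthTwinsAbove := by
  intro Δ hΔ lam hlam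
  have hlam' : hardCoreThreshold Δ < lam := hlam
  have hlam0 : 0 < lam := (hardCoreThreshold_pos hΔ).trans hlam'
  obtain ⟨A, γ, hγ, htw⟩ := linearGapTwins Δ hΔ lam hlam'
  refine ⟨(2 : ℝ)⁻¹, by norm_num, fun n₀ => ?_⟩
  obtain ⟨nv, s, N, G, H, hn₀, hnvN, hNA, hγs, hG, hH, hck, hZ⟩ :=
    htw (n₀ + 1 + ⌈24 / γ⌉₊ + ⌈576 * (A : ℝ) / γ ^ 2⌉₊)
  -- unpack the threshold
  have hnv1 : 1 ≤ nv := by omega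
  have hnvR : (0 : ℝ) ≤ nv := Nat.cast_nonneg nv
  have h24 : (24 : ℝ) ≤ γ * nv := by
    have h1 : (⌈24 / γ⌉₊ : ℝ) ≤ nv := by exact_mod_cast (show ⌈24 / γ⌉₊ ≤ nv by omega)
    have h2 : 24 / γ ≤ nv := (Nat.le_ceil _).trans h1
    rw [div_le_iff₀ hγ] at h2
    linarith
  have h576 : 576 * (A : ℝ) ≤ nv * γ ^ 2 := by
    have h1 : (⌈576 * (A : ℝ) / γ ^ 2⌉₊ : ℝ) ≤ nv := by
      exact_mod_cast (show ⌈576 * (A : ℝ) / γ ^ 2⌉₊ ≤ nv by omega)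
    have h2 : 576 * (A : ℝ) / γ ^ 2 ≤ nv := (Nat.le_ceil _).trans h1
    rwa [div_le_iff₀ (pow_pos hγ 2)] at h2
  -- the depth `k := s / 12`
  set k : ℕ := s / 12 with hk
  have hs24 : 24 ≤ s := by
    have : (24 : ℝ) ≤ s := h24.trans hγs
    exact_mod_cast this
  have hk1 : 1 ≤ k := by omega
  have hks : 12 * k ≤ s := by omega
  have hkR : γ * nv / 24 ≤ k := by
    have h1 : (s : ℝ) ≤ 12 * k + 11 := by exact_mod_cast (show s ≤ 12 * k + 11 by omega)
    linarith
  -- `N ≤ k²`, hence `N^{1/2} ≤ k`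
  have hN : (N : ℝ) ≤ (k : ℝ) ^ 2 := by
    have hAnv : (N : ℝ) ≤ A * nv := by exact_mod_cast hNA
    have h2 : (A : ℝ) * nv ≤ (γ * nv / 24) ^ 2 :=
      calc (A : ℝ) * nv = 576 * (A : ℝ) * nv / 576 := by ring
        _ ≤ nv * γ ^ 2 * nv / 576 :=
            div_le_div_of_nonneg_right (mul_le_mul_of_nonneg_right h576 hnvR) (by norm_num)
        _ = (γ * nv / 24) ^ 2 := by ring
    have h3 : (γ * nv / 24) ^ 2 ≤ (k : ℝ) ^ 2 := pow_le_pow_left₀ (by positivity) hkR 2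
    exact hAnv.trans (h2.trans h3)
  have hroot : (N : ℝ) ^ ((2 : ℝ)⁻¹) ≤ k := by
    have hk0 : (0 : ℝ) ≤ k := Nat.cast_nonneg k
    calc (N : ℝ) ^ ((2 : ℝ)⁻¹) ≤ ((k : ℝ) ^ 2) ^ ((2 : ℝ)⁻¹) :=
          Real.rpow_le_rpow (Nat.cast_nonneg N) hN (by norm_num)
      _ = k := by
          have := Real.pow_rpow_inv_natCast (n := 2) hk0 two_ne_zero
          simpa using this
  refine ⟨N, G, H, ?_, hG, hH, ?_, ?_⟩
  · -- order `≥ n₀`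
    calc n₀ ≤ nv := by omega
      _ ≤ N := hnvN
  · -- homomorphism indistinguishability below treewidth `N^{1/2} ≤ k`
    intro mF F hF
    have hFk : (treewidth F : ℝ) < k := hF.trans_le hroot
    have hFk' : treewidth F < k := by exact_mod_cast hFk
    exact Literature.ModelTheory.FiniteModelTheory.Dvorak2010.homCount_eq_of_ckEquiv hk1 (hck k hk1 hks) F hFk'
  · -- the factor-2 gap: `2 ≤ e^{nv}`
    have h2 : (2 : ℝ) ≤ Real.exp (nv : ℝ) := by
      have h1 : (1 : ℝ) ≤ nv := by exact_mod_cast hnv1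
      have := Real.add_one_le_exp (nv : ℝ)
      linarith
    have hZ' : Real.exp (nv : ℝ) * independencePolynomial H lam ≤ independencePolynomial G lam := by
      convert hZ using 2 <;> exact (indepSum_eq _ _).symm
    have key : 2 * independencePolynomial H lam ≤ independencePolynomial G lam :=
      (mul_le_mul_of_nonneg_right h2 (independencePolynomial_pos _ hlam0.le).le).trans hZ'
    convert key using 2 <;> exact indepSum_eq _ _

/-- **The transfer's second leg: `MacroscopicTwinsAbove` (crux #3, stmt-PneNP-2720) from the SAME stubs via C⁺**
(the card's "C⁺ ⇒ #2 ∧ #3"; density constant `δ := 1/(A+1)`, fixed before `k`; for each `k` ask for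
`nv ≥ 1 + ⌈12k/γ⌉`, so `12k ≤ γ nv ≤ s`). Bonus theorem: the skeleton audit for 2719 ignores it; 2720's lead may
register this file as a line of that crux too. -/
theorem macroscopicTwinsAbove_of_linearGap : MacroscopicTwinsAbove := by
  intro Δ hΔ lam hlam
  have hlam' : hardCoreThreshold Δ < lam := hlam
  have hlam0 : 0 < lam := (hardCoreThreshold_pos hΔ).trans hlam'
  obtain ⟨A, γ, hγ, htw⟩ := linearGapTwins Δ hΔ lam hlam'
  refine ⟨1 / ((A : ℝ) + 1), by positivity, fun k => ?_⟩
  obtain ⟨nv, s, N, G, H, hn₀, hnvN, hNA, hγs, hG, hH, hck, hZ⟩ := htw (1 + ⌈12 * (k : ℝ) / γ⌉₊)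
  have hnv1 : 1 ≤ nv := by omega
  have hks : 12 * k ≤ s := by
    have h1 : (⌈12 * (k : ℝ) / γ⌉₊ : ℝ) ≤ nv := by
      exact_mod_cast (show ⌈12 * (k : ℝ) / γ⌉₊ ≤ nv by omega)
    have h2 : 12 * (k : ℝ) / γ ≤ nv := (Nat.le_ceil _).trans h1
    rw [div_le_iff₀ hγ] at h2
    have h3 : 12 * (k : ℝ) ≤ s := by linarith
    exact_mod_cast h3
  refine ⟨N, G, H, by omega, hG, hH, ?_, ?_⟩
  · -- homomorphism indistinguishability below treewidth `k`
    intro mF F hF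
    rcases Nat.eq_zero_or_pos k with hk0 | hkpos
    · subst hk0
      exact absurd hF (Nat.not_lt_zero _)
    · exact Literature.ModelTheory.FiniteModelTheory.Dvorak2010.homCount_eq_of_ckEquiv hkpos (hck k hkpos hks) F hF
  · -- the macroscopic gap `e^{N/(A+1)} ≤ e^{nv}`
    have hδN : 1 / ((A : ℝ) + 1) * N ≤ nv := by
      have hA1 : (0 : ℝ) < (A : ℝ) + 1 := by positivity
      rw [one_div, inv_mul_le_iff₀ hA1]
      have h1 : (N : ℝ) ≤ A * nv := by exact_mod_cast hNA
      have hnvR : (0 : ℝ) ≤ nv := Nat.cast_nonneg nv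
      nlinarith
    have hZ' : Real.exp (nv : ℝ) * independencePolynomial H lam ≤ independencePolynomial G lam := by
      convert hZ using 2 <;> exact (indepSum_eq _ _).symm
    have key : Real.exp (1 / ((A : ℝ) + 1) * N) * independencePolynomial H lam ≤
        independencePolynomial G lam :=
      (mul_le_mul_of_nonneg_right (Real.exp_le_exp.2 hδN) (independencePolynomial_pos _ hlam0.le).le).trans hZ'
    convert key using 2 <;> exact indepSum_eq _ _

end Summit.PneNP.PneNP.Cruxes.PolyDepthTwinsAbove.LinearGapConstantGadgets
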